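import Summits.AnomalousDissipation.AnomalousDissipation.Theorems.SawtoothPulseCascadeK3NonlinearClosureWeakEnergyGrowth
import Literature.Analysis.FluidPDE.SawtoothCascadeDriftFree
import Literature.Analysis.FluidPDE.SawtoothCascadeResponseSourceBounds
import Literature.Analysis.FunctionSpaces.TorusFluidGlueProofs
import Literature.Analysis.FunctionSpaces.TorusLinearisedNSShear
import Mathlib.Analysis.InnerProductSpace.Projection.Submodule
import HarnessLib

/-!
# K3′ `K3NonlinearClosure` (aside, stmt-AnomalousDissipation-20027), line `Localised` — STUB S2c
`stub_halfPulseEnergyBound : ∀ P, DriftFree.HalfPulseEnergyBound P`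

The crude half-pulse operator bound for the WEAK `A = 1` class: every weak passive vector
(`Torus.IsWeakPassiveVectorOn 1`, Navier–Stokes linearised at the time-shifted cascade carrier) with an
`L²` datum grows in `L²` by at most `e^{γ}` over one half pulse, UNIFORMLY in `ν > 0`.  Assembly of
* the Leray reduction of the datum (`exists_weaklyDivFree_datum`: the weak formulation only sees the
  datum through its pairings with smooth divergence-free fields, so the datum may be replaced by its
  orthogonal projection onto the closed span of those fields in `L²` — weakly divergence free, of smaller norm);
* the production bound of the cascade shear on a half slot (`field_production_le_of_mem_H/V`:
  `∫⟪ū(t), (v·∇)v⟫ = −∫⟪(v·∇)ū(t), v⟫ ≤ ½ rate(t) ∫‖v‖²` for smooth divergence-free `v`, `|U_j′| ≤ 1`);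
* the ν-uniform weak energy inequality `K3NonlinearClosureLocalised.ae_integral_norm_sq_le_mul_exp`
  (p798498) and `∫ rate ≤ γ` over the half slot (`integral_rateH_le` / `integral_rateV_le`).
-/

-- `Summit.<Summit>.<Problem>`: single-conjunct summit, the duplicate namespace segment is deliberate.
set_option linter.dupNamespace false

noncomputable section

open MeasureTheory Set Filter Function TopologicalSpace
open scoped ENNReal NNReal InnerProductSpace Topology
open Literature.Analysis Literature.Analysis.FluidPDE Literature.Analysis.FluidPDE.Torus
open Literature.Analysis.FluidPDE.SawtoothCascade
open Literature.Analysis.FluidPDE.SawtoothCascade.DriftFree (HalfPulseEnergyBound)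

namespace Summit.AnomalousDissipation.AnomalousDissipation.Theorems.SawtoothPulseCascade.K3NonlinearClosureLocalised

section Leray

variable {d : Type*} [Fintype d] [DecidableEq d]

omit [DecidableEq d] in
/-- The `L²` pairing of an `L²` class with a smooth field is the integral of the pointwise pairing with the
smooth representative. [folklore] -/
theorem inner_toLp_smooth_eq_integral (U : Lp (EuclideanSpace ℝ d) 2 (volume : Measure (UnitAddTorus d)))
    {g : UnitAddTorus d → EuclideanSpace ℝ d} (hg : FunctionSpaces.Torus.IsSmooth g) :
    ⟪U, (hg.memLp 2).toLp g⟫_ℝ = ∫ x, ⟪(U : UnitAddTorus d → EuclideanSpace ℝ d) x, g x⟫_ℝ := by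
  rw [MeasureTheory.L2.inner_def]
  refine integral_congr_ae ?_
  filter_upwards [MemLp.coeFn_toLp (hg.memLp 2)] with x hx
  rw [hx]

/-- **Leray reduction of the datum of a weak passive vector.** The weak formulation of
`IsWeakPassiveVectorOn A T ν b w₀ w` sees the datum `w₀ ∈ L²` only through its pairings with smooth
divergence-free fields; replacing `w₀` by its orthogonal projection onto the closed span `K` of those fields
in `L²(T^d; ℝ^d)` gives a datum `w₀'` which is weakly divergence free (gradients of smooth functions are
orthogonal to `K`), has `∫‖w₀'‖² ≤ ∫‖w₀‖²`, and for which `w` is still a weak solution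
(Robinson–Rodrigo–Sadowski 2016, Thm. 2.6 / Def. 2.8: the Leray projector). [cite: RobinsonRodrigoSadowski2016, Thm. 2.6 and Def. 2.8 (Helmholtz–Weyl decomposition, Leray projector)] -/
theorem exists_weaklyDivFree_datum {A T ν : ℝ} {b w : ℝ → UnitAddTorus d → EuclideanSpace ℝ d}
    {w₀ : UnitAddTorus d → EuclideanSpace ℝ d}
    (h : IsWeakPassiveVectorOn A T ν b w₀ w) (hw₀ : MemLp w₀ 2 volume) :
    ∃ w₀' : UnitAddTorus d → EuclideanSpace ℝ d, MemLp w₀' 2 volume ∧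
      FunctionSpaces.Torus.IsWeaklyDivFree w₀' ∧
      (∫ x, ‖w₀' x‖ ^ 2 ≤ ∫ x, ‖w₀ x‖ ^ 2) ∧ IsWeakPassiveVectorOn A T ν b w₀' w := by
  classical
  -- the closed span of the smooth divergence-free fields in `L²`
  set S : Set (Lp (EuclideanSpace ℝ d) 2 (volume : Measure (UnitAddTorus d))) :=
    {v | ∃ f : UnitAddTorus d → EuclideanSpace ℝ d, FunctionSpaces.Torus.IsSmooth f ∧
      FunctionSpaces.Torus.IsDivFree f ∧ (v : UnitAddTorus d → EuclideanSpace ℝ d) =ᵐ[volume] f} with hS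
  set K : Submodule ℝ (Lp (EuclideanSpace ℝ d) 2 (volume : Measure (UnitAddTorus d))) :=
    (Submodule.span ℝ S).topologicalClosure with hK
  haveI : CompleteSpace K := (Submodule.isClosed_topologicalClosure (Submodule.span ℝ S)).completeSpace_coe
  set W₀ : Lp (EuclideanSpace ℝ d) 2 (volume : Measure (UnitAddTorus d)) := hw₀.toLp w₀ with hW₀
  set V : Lp (EuclideanSpace ℝ d) 2 (volume : Measure (UnitAddTorus d)) := K.starProjection W₀ with hV
  have hVK : V ∈ K := Submodule.starProjection_apply_mem K W₀
  -- gradients are orthogonal to `K`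
  have hgradS : ∀ {θ : UnitAddTorus d → ℝ} (hθ : FunctionSpaces.Torus.IsSmooth θ),
      (hθ.gradient.memLp 2).toLp (FunctionSpaces.Torus.gradient θ) ∈ (Submodule.span ℝ S)ᗮ := by
    intro θ hθ
    rw [Submodule.mem_orthogonal]
    intro u hu
    induction hu using Submodule.span_induction with
    | mem u hu =>
        obtain ⟨f, hf, hfdiv, huf⟩ := hu
        rw [inner_toLp_smooth_eq_integral u hθ.gradient]
        calc ∫ x, ⟪(u : UnitAddTorus d → EuclideanSpace ℝ d) x, FunctionSpaces.Torus.gradient θ x⟫_ℝ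
            = ∫ x, ⟪f x, FunctionSpaces.Torus.gradient θ x⟫_ℝ := by
              refine integral_congr_ae ?_
              filter_upwards [huf] with x hx
              rw [hx]
          _ = 0 := FunctionSpaces.Torus.IsDivFree.isWeaklyDivFree_holds hf hfdiv θ hθ
    | zero => exact inner_zero_left _
    | add u v _ _ hu hv => rw [inner_add_left, hu, hv, add_zero]
    | smul a u _ hu => rw [inner_smul_left, hu]; simp
  have hVperp : V ∈ (Submodule.span ℝ S)ᗮᗮ := by
    rw [Submodule.orthogonal_orthogonal_eq_closure]
    exact hVK
  -- pairings with smooth divergence-free fields are unchanged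
  have hpair : ∀ {φ : UnitAddTorus d → EuclideanSpace ℝ d}, FunctionSpaces.Torus.IsSmooth φ →
      FunctionSpaces.Torus.IsDivFree φ →
      ∫ x, ⟪w₀ x, φ x⟫_ℝ = ∫ x, ⟪(V : UnitAddTorus d → EuclideanSpace ℝ d) x, φ x⟫_ℝ := by
    intro φ hφ hφdiv
    set Φ : Lp (EuclideanSpace ℝ d) 2 (volume : Measure (UnitAddTorus d)) := (hφ.memLp 2).toLp φ with hΦ
    have hΦS : Φ ∈ S := ⟨φ, hφ, hφdiv, MemLp.coeFn_toLp _⟩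
    have hΦK : Φ ∈ K := Submodule.le_topologicalClosure _ (Submodule.subset_span hΦS)
    have e1 : ∫ x, ⟪w₀ x, φ x⟫_ℝ = ⟪W₀, Φ⟫_ℝ := by
      rw [inner_toLp_smooth_eq_integral W₀ hφ]
      refine integral_congr_ae ?_
      filter_upwards [MemLp.coeFn_toLp hw₀] with x hx
      rw [hx]
    calc ∫ x, ⟪w₀ x, φ x⟫_ℝ = ⟪W₀, Φ⟫_ℝ := e1
      _ = ⟪W₀, K.starProjection Φ⟫_ℝ := by rw [Submodule.starProjection_eq_self_iff.mpr hΦK]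
      _ = ⟪K.starProjection W₀, Φ⟫_ℝ := (Submodule.inner_starProjection_left_eq_right K W₀ Φ).symm
      _ = ∫ x, ⟪(V : UnitAddTorus d → EuclideanSpace ℝ d) x, φ x⟫_ℝ := inner_toLp_smooth_eq_integral V hφ
  refine ⟨(V : UnitAddTorus d → EuclideanSpace ℝ d), Lp.memLp V, ?_, ?_, ?_⟩
  · -- weakly divergence free
    intro θ hθ
    have h0 := Submodule.inner_left_of_mem_orthogonal (hgradS hθ) hVperp
    rwa [inner_toLp_smooth_eq_integral V hθ.gradient] at h0
  · -- norm
    have e1 : ∫ x, ‖(V : UnitAddTorus d → EuclideanSpace ℝ d) x‖ ^ 2 = ‖V‖ ^ 2 := by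
      rw [← real_inner_self_eq_norm_sq V, MeasureTheory.L2.inner_def]
      exact integral_congr_ae (ae_of_all _ fun x => (real_inner_self_eq_norm_sq _).symm)
    have e2 : ∫ x, ‖w₀ x‖ ^ 2 = ‖W₀‖ ^ 2 := by
      rw [← real_inner_self_eq_norm_sq W₀, MeasureTheory.L2.inner_def]
      refine integral_congr_ae ?_
      filter_upwards [MemLp.coeFn_toLp hw₀] with x hx
      rw [hx, real_inner_self_eq_norm_sq]
    rw [e1, e2]
    exact pow_le_pow_left₀ (norm_nonneg _) (Submodule.norm_starProjection_apply_le K W₀) 2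
  · exact
      { aestronglyMeasurable := h.aestronglyMeasurable
        aestronglyMeasurable_carrier := h.aestronglyMeasurable_carrier
        ae_lintegral_sq_le := h.ae_lintegral_sq_le
        lintegral_carrier_lt_top := h.lintegral_carrier_lt_top
        lintegral_mul_lt_top := h.lintegral_mul_lt_top
        ae_isWeaklyDivFree_carrier := h.ae_isWeaklyDivFree_carrier
        ae_isWeaklyDivFree := h.ae_isWeaklyDivFree
        weak_eq := fun Ψ hΨ hΨdiv => by
          rw [← hpair (hΨ.isSmooth_slice 0) (hΨdiv 0)]
          exact h.weak_eq Ψ hΨ hΨdiv }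

end Leray


/-! ## The cascade shear on a half slot: production bound, amplitude bound -/

section Cascade

open CascadeParams

variable (P : CascadeParams)

/-- **Production bound of the H half pulse**: for `t` in the H half slot of phase `j` (`γ ≥ 0`, `δ_j > 0`)
and every smooth divergence-free `v`, `∫⟪ū(t), (v·∇)v⟫ = −∫⟪(v·∇)ū(t), v⟫ ≤ ½ rateH_j(t) ∫‖v‖²`
(`ū(t) = rateH_j(t) U_j(x₂) e₁`, `|U_j′| ≤ 1`, `2|v₁v₂| ≤ ‖v‖²`). [cite: MajdaBertozziCUP2002, §3.1.1 Prop. 3.1 (3.7) (the stretching term)] -/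
theorem field_production_le_of_mem_H (hγ : 0 ≤ P.γ) {j : ℕ} (hδ : 0 < P.δ j) {t : ℝ}
    (ht : t ∈ Icc (tStart j) (tStart j + tHalf j)) {v : UnitAddTorus (Fin 2) → EuclideanSpace ℝ (Fin 2)}
    (hv : FunctionSpaces.Torus.IsSmooth v) (hvdiv : FunctionSpaces.Torus.IsDivFree v) :
    1 * ∫ x, ⟪P.field t x, FunctionSpaces.Torus.convect v v x⟫_ℝ ≤ P.rateH j t / 2 * ∫ x, ‖v x‖ ^ 2 := by
  have hus : FunctionSpaces.Torus.IsSmooth (P.field t) := P.isSmooth_field_of_mem_H hδ ht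
  have e1 : ∫ x, ⟪P.field t x, FunctionSpaces.Torus.convect v v x⟫_ℝ =
      -∫ x, ⟪FunctionSpaces.Torus.convect v (P.field t) x, v x⟫_ℝ := by
    calc ∫ x, ⟪P.field t x, FunctionSpaces.Torus.convect v v x⟫_ℝ
        = ∫ x, ⟪FunctionSpaces.Torus.convect v v x, P.field t x⟫_ℝ :=
          integral_congr_ae (ae_of_all _ fun x => real_inner_comm _ _)
      _ = -∫ x, ⟪v x, FunctionSpaces.Torus.convect v (P.field t) x⟫_ℝ :=
          FunctionSpaces.Torus.integral_inner_convect_eq_neg hv hvdiv hv hus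
      _ = -∫ x, ⟪FunctionSpaces.Torus.convect v (P.field t) x, v x⟫_ℝ := by
          rw [integral_congr_ae (ae_of_all _ fun x => real_inner_comm (FunctionSpaces.Torus.convect v (P.field t) x) (v x))]
  have hpw : ∀ x, 2 * |⟪FunctionSpaces.Torus.convect v (P.field t) x, v x⟫_ℝ| ≤ P.rateH j t * ‖v x‖ ^ 2 := by
    intro x
    have h2 := FunctionSpaces.Torus.two_mul_abs_inner_convect_le_of_shear (w := v) hus (k := (1 : Fin 2)) (m := 0)
      (by decide) (x := x) (c := P.rateH j t * deriv (P.U j) (FunctionSpaces.Torus.repr x 1))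
      (fun i hi => by
        obtain rfl : i = 0 := by omega
        exact (P.partialDeriv_field_of_mem_H ht x).1)
      (P.partialDeriv_field_of_mem_H ht x).2
    refine h2.trans (mul_le_mul_of_nonneg_right ?_ (sq_nonneg _))
    rw [abs_mul, abs_of_nonneg (P.rateH_nonneg hγ j t)]
    calc P.rateH j t * |deriv (P.U j) (FunctionSpaces.Torus.repr x 1)| ≤ P.rateH j t * 1 :=
          mul_le_mul_of_nonneg_left (P.abs_deriv_U_le_one hδ _) (P.rateH_nonneg hγ j t)
      _ = P.rateH j t := mul_one _
  have hI : |∫ x, ⟪FunctionSpaces.Torus.convect v (P.field t) x, v x⟫_ℝ| ≤ P.rateH j t / 2 * ∫ x, ‖v x‖ ^ 2 := by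
    calc |∫ x, ⟪FunctionSpaces.Torus.convect v (P.field t) x, v x⟫_ℝ|
        ≤ ∫ x, |⟪FunctionSpaces.Torus.convect v (P.field t) x, v x⟫_ℝ| := abs_integral_le_integral_abs
      _ ≤ ∫ x, P.rateH j t / 2 * ‖v x‖ ^ 2 := by
          refine integral_mono_of_nonneg (Eventually.of_forall fun x => abs_nonneg _)
            ((hv.norm_sq.integrable).const_mul _) (Eventually.of_forall fun x => ?_)
          have := hpw x
          linarith
      _ = P.rateH j t / 2 * ∫ x, ‖v x‖ ^ 2 := integral_const_mul _ _
  rw [one_mul, e1]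
  have := neg_abs_le (∫ x, ⟪FunctionSpaces.Torus.convect v (P.field t) x, v x⟫_ℝ)
  linarith [abs_nonneg (∫ x, ⟪FunctionSpaces.Torus.convect v (P.field t) x, v x⟫_ℝ), neg_le_abs (∫ x, ⟪FunctionSpaces.Torus.convect v (P.field t) x, v x⟫_ℝ)]

/-- **Production bound of the V half pulse**: as `field_production_le_of_mem_H` on the V half slot with the
rate `rateV_j` (`ū(t) = rateV_j(t) U_j(x₁) e₂`). [cite: MajdaBertozziCUP2002, §3.1.1 Prop. 3.1 (3.7) (the stretching term)] -/
theorem field_production_le_of_mem_V (hγ : 0 ≤ P.γ) {j : ℕ} (hδ : 0 < P.δ j) {t : ℝ}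
    (ht : t ∈ Icc (tStart j + tHalf j) (tStart (j + 1))) {v : UnitAddTorus (Fin 2) → EuclideanSpace ℝ (Fin 2)}
    (hv : FunctionSpaces.Torus.IsSmooth v) (hvdiv : FunctionSpaces.Torus.IsDivFree v) :
    1 * ∫ x, ⟪P.field t x, FunctionSpaces.Torus.convect v v x⟫_ℝ ≤ P.rateV j t / 2 * ∫ x, ‖v x‖ ^ 2 := by
  have hus : FunctionSpaces.Torus.IsSmooth (P.field t) := P.isSmooth_field_of_mem_V hδ ht
  have e1 : ∫ x, ⟪P.field t x, FunctionSpaces.Torus.convect v v x⟫_ℝ =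
      -∫ x, ⟪FunctionSpaces.Torus.convect v (P.field t) x, v x⟫_ℝ := by
    calc ∫ x, ⟪P.field t x, FunctionSpaces.Torus.convect v v x⟫_ℝ
        = ∫ x, ⟪FunctionSpaces.Torus.convect v v x, P.field t x⟫_ℝ :=
          integral_congr_ae (ae_of_all _ fun x => real_inner_comm _ _)
      _ = -∫ x, ⟪v x, FunctionSpaces.Torus.convect v (P.field t) x⟫_ℝ :=
          FunctionSpaces.Torus.integral_inner_convect_eq_neg hv hvdiv hv hus
      _ = -∫ x, ⟪FunctionSpaces.Torus.convect v (P.field t) x, v x⟫_ℝ := by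
          rw [integral_congr_ae (ae_of_all _ fun x => real_inner_comm (FunctionSpaces.Torus.convect v (P.field t) x) (v x))]
  have hpw : ∀ x, 2 * |⟪FunctionSpaces.Torus.convect v (P.field t) x, v x⟫_ℝ| ≤ P.rateV j t * ‖v x‖ ^ 2 := by
    intro x
    have h2 := FunctionSpaces.Torus.two_mul_abs_inner_convect_le_of_shear (w := v) hus (k := (0 : Fin 2)) (m := 1)
      (by decide) (x := x) (c := P.rateV j t * deriv (P.U j) (FunctionSpaces.Torus.repr x 0))
      (fun i hi => by
        obtain rfl : i = 1 := by omega
        exact (P.partialDeriv_field_of_mem_V ht x).1)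
      (P.partialDeriv_field_of_mem_V ht x).2
    refine h2.trans (mul_le_mul_of_nonneg_right ?_ (sq_nonneg _))
    rw [abs_mul, abs_of_nonneg (P.rateV_nonneg hγ j t)]
    calc P.rateV j t * |deriv (P.U j) (FunctionSpaces.Torus.repr x 0)| ≤ P.rateV j t * 1 :=
          mul_le_mul_of_nonneg_left (P.abs_deriv_U_le_one hδ _) (P.rateV_nonneg hγ j t)
      _ = P.rateV j t := mul_one _
  have hI : |∫ x, ⟪FunctionSpaces.Torus.convect v (P.field t) x, v x⟫_ℝ| ≤ P.rateV j t / 2 * ∫ x, ‖v x‖ ^ 2 := by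
    calc |∫ x, ⟪FunctionSpaces.Torus.convect v (P.field t) x, v x⟫_ℝ|
        ≤ ∫ x, |⟪FunctionSpaces.Torus.convect v (P.field t) x, v x⟫_ℝ| := abs_integral_le_integral_abs
      _ ≤ ∫ x, P.rateV j t / 2 * ‖v x‖ ^ 2 := by
          refine integral_mono_of_nonneg (Eventually.of_forall fun x => abs_nonneg _)
            ((hv.norm_sq.integrable).const_mul _) (Eventually.of_forall fun x => ?_)
          have := hpw x
          linarith
      _ = P.rateV j t / 2 * ∫ x, ‖v x‖ ^ 2 := integral_const_mul _ _
  rw [one_mul, e1]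
  linarith [neg_le_abs (∫ x, ⟪FunctionSpaces.Torus.convect v (P.field t) x, v x⟫_ℝ)]

/-- The profile `U_j` is bounded (`δ_j > 0`: it is continuous and `1`-periodic). [folklore] -/
theorem exists_abs_U_le {j : ℕ} (hδ : 0 < P.δ j) : ∃ CU : ℝ, 0 ≤ CU ∧ ∀ y, |P.U j y| ≤ CU := by
  obtain ⟨C, hC⟩ := isCompact_Icc.exists_bound_of_continuousOn
    ((P.contDiff_U hδ (n := 0)).continuous.continuousOn (s := Icc (0 : ℝ) 1))
  refine ⟨max C 0, le_max_right _ _, fun y => ?_⟩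
  obtain ⟨z, hz, hyz⟩ := (P.U_periodic j).exists_mem_Ico₀ one_pos y
  rw [hyz, ← Real.norm_eq_abs]
  exact (hC z (Ico_subset_Icc_self hz)).trans (le_max_left _ _)

/-- `‖(a, 0)‖ = |a|` in `ℝ²`. [folklore] -/
theorem norm_toLp_pair_zero_right (a : ℝ) : ‖WithLp.toLp 2 ![a, (0 : ℝ)]‖ = |a| := by
  rw [EuclideanSpace.norm_eq, Fin.sum_univ_two]
  simp only [Matrix.cons_val_zero, Matrix.cons_val_one, Real.norm_eq_abs, abs_zero, ne_eq,
    OfNat.ofNat_ne_zero, not_false_eq_true, zero_pow, add_zero]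
  rw [Real.sqrt_sq (abs_nonneg a)]

/-- `‖(0, a)‖ = |a|` in `ℝ²`. [folklore] -/
theorem norm_toLp_pair_zero_left (a : ℝ) : ‖WithLp.toLp 2 ![(0 : ℝ), a]‖ = |a| := by
  rw [EuclideanSpace.norm_eq, Fin.sum_univ_two]
  simp only [Matrix.cons_val_zero, Matrix.cons_val_one, Real.norm_eq_abs, abs_zero, ne_eq,
    OfNat.ofNat_ne_zero, not_false_eq_true, zero_pow, zero_add]
  rw [Real.sqrt_sq (abs_nonneg a)]

/-- **The cascade field is bounded on each H half slot**: `‖ū(t,x)‖ ≤ R · sup|U_j|` with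
`R = max |rateH_j|` over the slot. [cite: ElgindiLissMattingly2025, §1 (u_α = H_α(x₂) e₁ on its half period)] -/
theorem exists_norm_field_le_of_H {j : ℕ} (hδ : 0 < P.δ j) :
    ∃ Mb : ℝ, ∀ t ∈ Icc (tStart j) (tStart j + tHalf j), ∀ x, ‖P.field t x‖ ≤ Mb := by
  obtain ⟨R, hR⟩ := isCompact_Icc.exists_bound_of_continuousOn
    ((P.continuous_rateH j).continuousOn (s := Icc (tStart j) (tStart j + tHalf j)))
  obtain ⟨CU, hCU0, hCU⟩ := exists_abs_U_le P hδ
  refine ⟨R * CU, fun t ht x => ?_⟩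
  rw [P.field_eq_of_mem_H ht x, norm_toLp_pair_zero_right, abs_mul]
  exact mul_le_mul ((Real.norm_eq_abs _).symm.le.trans (hR t ht)) (hCU _) (abs_nonneg _)
    ((norm_nonneg _).trans (hR t ht))

/-- **The cascade field is bounded on each V half slot**. [cite: ElgindiLissMattingly2025, §1 (u_α = V_α(x₁) e₂ on its half period)] -/
theorem exists_norm_field_le_of_V {j : ℕ} (hδ : 0 < P.δ j) :
    ∃ Mb : ℝ, ∀ t ∈ Icc (tStart j + tHalf j) (tStart (j + 1)), ∀ x, ‖P.field t x‖ ≤ Mb := by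
  obtain ⟨R, hR⟩ := isCompact_Icc.exists_bound_of_continuousOn
    ((P.continuous_rateV j).continuousOn (s := Icc (tStart j + tHalf j) (tStart (j + 1))))
  obtain ⟨CU, hCU0, hCU⟩ := exists_abs_U_le P hδ
  refine ⟨R * CU, fun t ht x => ?_⟩
  rw [P.field_eq_of_mem_V ht x, norm_toLp_pair_zero_left, abs_mul]
  exact mul_le_mul ((Real.norm_eq_abs _).symm.le.trans (hR t ht)) (hCU _) (abs_nonneg _)
    ((norm_nonneg _).trans (hR t ht))

end Cascade

/-! ## Assembly -/

section Assembly

open CascadeParams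

/-- **Half-pulse bound from a shear structure on the shifted window** (the common part of the H and V
cases): if on `(0, tHalf j₀)` the shifted carrier `s ↦ ū(a + s)` is bounded, has the production bound
`∫⟪ū(a+s), (v·∇)v⟫ ≤ ½ r(a+s) ∫‖v‖²` on smooth divergence-free `v` with a continuous rate `r ≥ 0` of
partial strain `∫₀ᵗ r(a+s) ds ≤ γ`, then every weak passive vector (`A = 1`) about it with an `L²` datum
obeys `∫‖w(t)‖² ≤ e^{γ} ∫‖w₀‖²` for a.e. `t` (Leray reduction of the datum + the ν-uniform weak energy
inequality). [cite: MajdaBertozziCUP2002, §3.1.1 Prop. 3.1 (3.7) (energy growth by the velocity-gradient rate)] -/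
theorem halfPulse_of_rate (P : CascadeParams) {ν a : ℝ} {j₀ : ℕ} {r : ℝ → ℝ} (hrc : Continuous r)
    (hr0 : ∀ s, 0 ≤ r s)
    (hint : ∀ t ∈ Icc (0 : ℝ) (tHalf j₀), ∫ s in (0 : ℝ)..t, r (a + s) ≤ P.γ)
    (hprod : ∀ s ∈ Ioo (0 : ℝ) (tHalf j₀), ∀ v : UnitAddTorus (Fin 2) → EuclideanSpace ℝ (Fin 2),
      FunctionSpaces.Torus.IsSmooth v → FunctionSpaces.Torus.IsDivFree v →
      1 * ∫ x, ⟪P.field (a + s) x, FunctionSpaces.Torus.convect v v x⟫_ℝ ≤ r (a + s) / 2 * ∫ x, ‖v x‖ ^ 2)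
    {Mb : ℝ} (hbd : ∀ s ∈ Ioo (0 : ℝ) (tHalf j₀), ∀ x, ‖P.field (a + s) x‖ ≤ Mb)
    (hν : 0 < ν) {w₀ : UnitAddTorus (Fin 2) → EuclideanSpace ℝ (Fin 2)}
    {w : ℝ → UnitAddTorus (Fin 2) → EuclideanSpace ℝ (Fin 2)} (hw₀ : MemLp w₀ 2 volume)
    (hw : IsWeakPassiveVectorOn 1 (tHalf j₀) ν (fun t => P.field (a + t)) w₀ w) :
    ∀ᵐ t ∂(volume.restrict (Ioo 0 (tHalf j₀))), vectorL2Sq (w t) ≤ Real.exp P.γ * vectorL2Sq w₀ := by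
  obtain ⟨w₀', hw₀', hdiv', hle', hw'⟩ := exists_weaklyDivFree_datum hw hw₀
  -- the shifted carrier is essentially bounded on the window
  have hb : MemLp (FunctionSpaces.Torus.stLift fun t => P.field (a + t)) ∞
      (volume.restrict (Ioo 0 (tHalf j₀) ×ˢ (univ : Set (EuclideanSpace ℝ (Fin 2))))) := by
    refine memLp_top_of_bound hw.aestronglyMeasurable_carrier Mb ?_
    rw [ae_restrict_iff' (measurableSet_Ioo.prod MeasurableSet.univ)]
    exact ae_of_all _ fun z hz => by
      rw [show z = (z.1, z.2) from rfl, FunctionSpaces.Torus.stLift_apply]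
      exact hbd z.1 hz.1 _
  -- the ν-uniform weak energy inequality with `Λ(s) = r(a+s)/2`
  have hΛc : Continuous fun s => r (a + s) / 2 := (hrc.comp (continuous_const.add continuous_id)).div_const 2
  have hΛ0 : ∀ s, 0 ≤ r (a + s) / 2 := fun s => by have := hr0 (a + s); positivity
  have hprod' : ∀ᵐ s ∂(volume.restrict (Ioo 0 (tHalf j₀))), ∀ v : UnitAddTorus (Fin 2) → EuclideanSpace ℝ (Fin 2),
      FunctionSpaces.Torus.IsSmooth v → FunctionSpaces.Torus.IsDivFree v →
      1 * ∫ x, ⟪P.field (a + s) x, FunctionSpaces.Torus.convect v v x⟫_ℝ ≤ r (a + s) / 2 * ∫ x, ‖v x‖ ^ 2 :=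
    (ae_restrict_iff' measurableSet_Ioo).2 (ae_of_all _ hprod)
  have hmain := ae_integral_norm_sq_le_mul_exp hw' hν hw₀' hdiv' hb hΛc hΛ0 hprod'
  filter_upwards [hmain, ae_restrict_mem measurableSet_Ioo] with t ht htI
  have hexp : Real.exp (∫ s in (0 : ℝ)..t, 2 * (r (a + s) / 2)) ≤ Real.exp P.γ := by
    refine Real.exp_le_exp.2 ?_
    have e : ∫ s in (0 : ℝ)..t, 2 * (r (a + s) / 2) = ∫ s in (0 : ℝ)..t, r (a + s) :=
      intervalIntegral.integral_congr fun s _ => by ring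
    rw [e]
    exact hint t ⟨htI.1.le, htI.2.le⟩
  have h0 : 0 ≤ ∫ x, ‖w₀' x‖ ^ 2 := integral_nonneg fun x => sq_nonneg _
  unfold vectorL2Sq
  calc ∫ x, ‖w t x‖ ^ 2 ≤ (∫ x, ‖w₀' x‖ ^ 2) * Real.exp (∫ s in (0 : ℝ)..t, 2 * (r (a + s) / 2)) := ht
    _ ≤ (∫ x, ‖w₀ x‖ ^ 2) * Real.exp P.γ :=
        mul_le_mul hle' hexp (Real.exp_pos _).le (integral_nonneg fun x => sq_nonneg _)
    _ = Real.exp P.γ * ∫ x, ‖w₀ x‖ ^ 2 := mul_comm _ _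

/-- **The crude half-pulse energy bound at every parameter point** (`DriftFree.HalfPulseEnergyBound P`): every
weak passive vector (`A = 1`, Navier–Stokes linearised at the time-shifted cascade carrier) over one half pulse
with an `L²` datum grows in `L²` by at most `e^{γ}`, uniformly in `ν > 0`. [cite: MajdaBertozziCUP2002, §3.1.1 Prop. 3.1 (3.7) (energy growth by the velocity-gradient rate)] -/
theorem halfPulseEnergyBound (P : CascadeParams) : DriftFree.HalfPulseEnergyBound P := by
  intro ν j₀ hz w₀ w hν hγ hδ₀ hd hw₀ hw
  have hδj : ∀ j, 0 < P.δ j := fun j => P.δ_pos hδ₀ (lt_of_lt_of_le one_pos hd) j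
  cases hz with
  | true =>
    -- H half slot: `tInject j₀ true = tStart j₀`
    have ha : tInject j₀ true = tStart j₀ := by simp [tInject]
    rw [ha] at hw
    obtain ⟨Mb, hMb⟩ := exists_norm_field_le_of_H P (hδj j₀)
    have hmem : ∀ s ∈ Icc (0 : ℝ) (tHalf j₀), tStart j₀ + s ∈ Icc (tStart j₀) (tStart j₀ + tHalf j₀) :=
      fun s hs => ⟨by linarith [hs.1], by linarith [hs.2]⟩
    refine halfPulse_of_rate P (r := P.rateH j₀) (P.continuous_rateH j₀) (fun s => P.rateH_nonneg hγ j₀ s)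
      (fun t ht => ?_) (fun s hs v hv hvdiv => field_production_le_of_mem_H P hγ (hδj j₀) (hmem s (Ioo_subset_Icc_self hs)) hv hvdiv)
      (fun s hs x => hMb _ (hmem s (Ioo_subset_Icc_self hs)) x) hν hw₀ hw
    rw [intervalIntegral.integral_comp_add_left (fun s => P.rateH j₀ s) (tStart j₀), add_zero]
    exact P.integral_rateH_le hγ (hmem t ht)
  | false =>
    -- V half slot: `tInject j₀ false = tStart j₀ + tHalf j₀`
    have ha : tInject j₀ false = tStart j₀ + tHalf j₀ := by simp [tInject]
    rw [ha] at hw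
    obtain ⟨Mb, hMb⟩ := exists_norm_field_le_of_V P (hδj j₀)
    have hmem : ∀ s ∈ Icc (0 : ℝ) (tHalf j₀),
        tStart j₀ + tHalf j₀ + s ∈ Icc (tStart j₀ + tHalf j₀) (tStart (j₀ + 1)) :=
      fun s hs => ⟨by linarith [hs.1], by rw [tStart_succ]; linarith [hs.2]⟩
    refine halfPulse_of_rate P (r := P.rateV j₀) (P.continuous_rateV j₀) (fun s => P.rateV_nonneg hγ j₀ s)
      (fun t ht => ?_) (fun s hs v hv hvdiv => field_production_le_of_mem_V P hγ (hδj j₀) (hmem s (Ioo_subset_Icc_self hs)) hv hvdiv)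
      (fun s hs x => hMb _ (hmem s (Ioo_subset_Icc_self hs)) x) hν hw₀ hw
    rw [intervalIntegral.integral_comp_add_left (fun s => P.rateV j₀ s) (tStart j₀ + tHalf j₀), add_zero]
    exact P.integral_rateV_le hγ (hmem t ht)

end Assembly

/-- **STUB S2c `stub_halfPulseEnergyBound`** of line `Localised` of the aside `K3NonlinearClosure`
(stmt-AnomalousDissipation-20027), by name and registered signature: the crude half-pulse energy bound
`DriftFree.HalfPulseEnergyBound P` at EVERY parameter point `P` (`halfPulseEnergyBound`). -/
theorem stub_halfPulseEnergyBound : ∀ P : CascadeParams, HalfPulseEnergyBound P :=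
  halfPulseEnergyBound

end Summit.AnomalousDissipation.AnomalousDissipation.Theorems.SawtoothPulseCascade.K3NonlinearClosureLocalised

end
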